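import Summits.RiemannHypothesis.RiemannHypothesis.Theorems.TiltedLandingLaw421R3BudgetTableB
import Summits.RiemannHypothesis.RiemannHypothesis.Theorems.TiltedLandingLaw421R3HeavyPairSplit

/-!
# K-2 WITHOUT THE FLOOR AT `z` (IMAGE Q v2 — C2 g53, W-08 ⟨33346⟩; director (CA803)(2) / (CA807)(A) / (CA813))

QUESTION (director-rh g27, (CA803)(2)): «K-2 chain sensitivity to λ_z = 29 vs 30».  ANSWER: NIL, certified here in kernel — the z-floor binder
`30 ≤ Im z·stateKappa f j z` of `RhW08.PerturbativeRung2.PerturbativeDropLightPairQ` is dead weight in the landed proof of K-2 (`RhW08.BudgetTable.k2`,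
#1224): the three analytic leaves of the budget — `RhW08.BudgetCaseA.budget_caseA` (`t_v ≥ 3/2`), `RhW08.BudgetCaseB1.budget_caseB1` (`t_v < 3/2, t_z ≥ 5`),
`RhW08.BudgetBox.budget_box_cell` (the perturbative box on a cell of the landed cover `RhW08.BudgetTable.cellCover_half`) — do not have it among their
hypotheses, and in the compose `RhW08.LightPairDrop.perturbativeDropLightPairQ_of_budget` its only use (image E's door smallness at `z`,
`(9/2)(1+μ₀) ≤ (Im z·‖K_z‖)²/2`, i.e. `Im z·‖K_z‖ ≥ 3.68`) is supplied by the PAIR COHERENCE that the hull clause of `LightPairAt` already gives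
(`RhW08.BudgetCaseA.explicit_coherence`: `‖K_z − K_v‖ ≤ 6/Im v`, whence `Im z·‖K_z‖ ≥ Im v·κ_v − 13/2 ≥ 47/2`).
CONTENTS (new mathematics: none — statements differ from the landed ones by ONE DELETED BINDER; every analytic step is a tree theorem BY NAME; no leaf re-proofs):
§1 `GeometricBudgetNoZ C μ₀` := `RhW08.LightPairDrop.GeometricBudget C μ₀` minus the binder `30 ≤ Im z·‖K_z + i/(2 Im z)‖`; ★ `geometricBudgetNoZ_ten_half :
   GeometricBudgetNoZ 10 (1/2)` re-dispatched through the three landed leaves + `cellCover_half`; `geometricBudget_of_noZ` (it implies the tree's budget).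
§2 `PerturbativeDropLightPairNoZQ C μ₀` := K-2's target law minus the binder `30 ≤ Im z·stateKappa f j z`; ★★ `k2Z : PerturbativeDropLightPairNoZQ 10 (1/2)`
   HYPOTHESIS-FREE (the compose replayed, door smallness at `z` from coherence; uses `μ₀ ≤ 1/2` for `explicit_coherence`); `perturbativeDropLightPairQ_of_noZ`
   (K-2′ ⇒ K-2) and `k2_again` (the tree's K-2 re-derived).
§3 GLUE «light pairs ⇒ X ≥ 5/2, floor at `v` only» (★ `five_halves_of_lightPair`; in particular image P's regime 1 `HeavySubfloorZQ` restricted to light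
   pairs, ★ `heavySubfloorZ_light`), the z-floor-FREE heavy socket `NearMassMonotonePairNoZQ μ₀` := {β-level, `λ_v ≥ 30`, `¬ LightPairAt μ₀`} ⇒ `X ≥ 5/2`
   (weaker than the tree's `NearMassMonotonePairQ μ₀`: `nearMassMonotonePairNoZQ_of_pair`) with ★ `rungP_of_noZ_instance : NearMassMonotonePairNoZQ (1/2) → RungP`,
   its EXACT split `… ↔ HeavyNearCoincidentNoZQ ∧ HeavyMassNoZQ μ₀` (regimes 2′/3′ = image P's regimes 2/3 WITHOUT the floor at `z`), ★ `rungP_of_two`;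
   and the FOLD of image P's regime 1 (tree `RhW08.HeavyPairSplit`, #1228): its heavy remainder `HeavySubfloorHeavyQ μ₀` (`λ_z < 30 ∧ ¬ LightPairAt μ₀`)
   gives `RhW08.HeavyPairSplit.HeavySubfloorZQ` BY NAME given `k2Z` (★ `heavySubfloorZ_of_remainder`) and is itself implied by regimes 2′ ∧ 3′ (`remainder_of_two`).
§4 by-name fold against #1228: `heavyNearCoincidentQ_of_noZ`, `heavyMassQ_of_noZ`, `noZ_of_split3`, ★ `split3_iff_two_half :
   (HeavySubfloorZQ ∧ HeavyNearCoincidentQ ∧ HeavyMassQ (1/2)) ↔ (HeavyNearCoincidentNoZQ ∧ HeavyMassNoZQ (1/2))` — at `μ₀ = 1/2` P's three sockets and the two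
   z-floor-free ones are EQUIVALENT.
STATUS: image candidate (support); TWO imports (#1224 `…R3BudgetTableB`, #1228 `…R3HeavyPairSplit`); no `sorry`, no new axiom, no instance/notation.  Nothing here bears on the truth of RH; RH is NOT
proved; the heavy sockets, RUNG-P's use toward `TiltedLandingLaw421R`, ⟨33346⟩/⟨33347⟩ are OPEN; checked ≠ landed ≠ proved. -/
namespace RhW08.K2NoZFloor

open Complex
open scoped ComplexConjugate
open RhW08.AntiEscapeSplit7 (newtonK)
open RhW08.UncoveredSign (pairPull)
open RhW08.TouchedDissipation (Touches AtomicPair pairUnion childEnergy stateKappa)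
open RhW08.PerturbativeRung (LightWitness LightAt BetaLevel RungP)
open RhW08.PerturbativeRung2 (LightPairAt PerturbativeDropLightPairQ NearMassMonotonePairQ lightAt_of_lightPairAt)
open RhW08.LightPairDrop (GeometricBudget im_mul_norm_ge im_explicit)
open RhW08.BudgetCaseA (budget_caseA explicit_coherence)
open RhW08.BudgetCaseB1 (budget_caseB1)
open RhW08.BudgetBox (CellCover budget_box_cell)
open RhW08.BudgetTable (cellCover_half)
open RhW08.HeavyPairSplit (HeavySubfloorZQ HeavyNearCoincidentQ HeavyMassQ sep_of_lightPairAt lightPairAt_mono nearMassMonotonePairQ_of_split)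

/-! ## §1 The geometric budget without the z-floor -/

/-- §1 `RhW08.LightPairDrop.GeometricBudget C μ₀` with the binder `30 ≤ Im z·‖K_z + i/(2 Im z)‖` DELETED (all other binders verbatim, same order). -/
def GeometricBudgetNoZ (C μ₀ : ℝ) : Prop :=
  ∀ (v z Rv Rz Kv Kz u₁ u₂ : ℂ) (M : ℝ),
    0 < v.im → v.im < z.im → |v.re - z.re| ≤ v.im + z.im → v.im ≤ 2 * ‖v - z‖ → 0 ≤ M → M ≤ μ₀ →
    Kv = (v - conj v)⁻¹ + (v - z)⁻¹ + (v - conj z)⁻¹ + Rv → Kz = (z - conj z)⁻¹ + (z - v)⁻¹ + (z - conj v)⁻¹ + Rz →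
    Rv.im ≤ 0 → Rz.im ≤ 0 → ‖Rz - Rv‖ ≤ M * ‖z - v‖ / (v.im * z.im) →
    30 ≤ v.im * ‖Kv + I / (2 * (v.im : ℂ))‖ →
    ‖u₁ - (v - Kv⁻¹)‖ ≤ (9 / 5) * (μ₀ / (v.im * ‖Kv‖) ^ 2) / ‖Kv‖ → ‖u₂ - (z - Kz⁻¹)‖ ≤ (9 / 5) * (μ₀ / (z.im * ‖Kz‖) ^ 2) / ‖Kz‖ →
    3 - C * (1 + μ₀) / (v.im * ‖Kv + I / (2 * (v.im : ℂ))‖) ≤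
      ((v.im ^ 2 + z.im ^ 2) - (u₁.im ^ 2 + u₂.im ^ 2)) * ‖Kv + I / (2 * (v.im : ℂ))‖ ^ 2

/-- §1 the z-floor-free budget implies the tree's budget (it has one binder fewer). -/
theorem geometricBudget_of_noZ {C μ₀ : ℝ} (h : GeometricBudgetNoZ C μ₀) : GeometricBudget C μ₀ :=
  fun v z Rv Rz Kv Kz u₁ u₂ M hv hvz ht hsep hM0 hMμ hKv hKz hRv hRz hR hflv _ hd₁ hd₂ =>
    h v z Rv Rz Kv Kz u₁ u₂ M hv hvz ht hsep hM0 hMμ hKv hKz hRv hRz hR hflv hd₁ hd₂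

/-- ★ §1 `CellCover μ₀ → GeometricBudgetNoZ 10 μ₀` (`μ₀ ≤ 1/2`): case (A) = tree `budget_caseA`, case (B1) = tree `budget_caseB1`, the perturbative box =
tree `budget_box_cell` on the cell the cover supplies — NONE of the three takes the z-floor. -/
theorem geometricBudgetNoZ_ten_of_cellCover {μ₀ : ℝ} (hμ : μ₀ ≤ 1 / 2) (hC : CellCover μ₀) : GeometricBudgetNoZ 10 μ₀ := by
  intro v z Rv Rz Kv Kz u₁ u₂ M hv hvz ht hsep hM0 hMμ hKv hKz hRv hRz hR hflv hd₁ hd₂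
  by_cases hA : 3 / 2 ≤ -(v.im * Kv.im)
  · exact budget_caseA hμ hv hvz ht hsep hM0 hMμ hKv hKz hRz hR hflv hd₁ hd₂ hA
  · by_cases h5 : 5 ≤ -(z.im * Kz.im)
    · exact budget_caseB1 hμ hv hvz ht hsep hM0 hMμ hKv hKz hRv hRz hR hflv hd₁ hd₂ (not_le.mp hA) h5
    · obtain ⟨S₀, T₁, e₁, r₁, β₀, hS0, hS, hT, hT10, hE, hr, hβ1, hβ, hPlo, hPhi, hOK⟩ := hC v z hv hvz ht hsep
      exact budget_box_cell hμ hv hvz hsep hM0 hMμ hKv hKz hRv hRz hR hflv hd₁ hd₂ (not_le.mp hA) (not_le.mp h5)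
        hS0 hS hT hT10 hE hr hβ1 hβ hPlo hPhi hOK

/-- ★ §1 THE BUDGET OF RECORD WITHOUT THE z-FLOOR: `GeometricBudgetNoZ 10 (1/2)` (tree `cellCover_half`, #1224). -/
theorem geometricBudgetNoZ_ten_half : GeometricBudgetNoZ 10 (1 / 2) :=
  geometricBudgetNoZ_ten_of_cellCover (by norm_num) cellCover_half

/-! ## §2 K-2 without the z-floor -/

/-- §2 ★ K-2′ — `RhW08.PerturbativeRung2.PerturbativeDropLightPairQ C μ₀` with the binder `30 ≤ Im z·stateKappa f j z` DELETED:
on a β-level above the floor at `v` whose pair is light within `μ₀`, `X ≥ 3 − C(1+μ₀)/λ_v` — whatever the field strength at `z`. -/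
def PerturbativeDropLightPairNoZQ (C μ₀ : ℝ) : Prop :=
  ∀ (η : ℝ) (f : ℂ → ℂ) (x₀ s hmax R Hs : ℝ) (B : ℕ), RhIdea6.G17.W07C7.Rev6.EngineHyps5 2 η f x₀ s hmax R Hs B →
    ∀ (j : ℕ) (v z : ℂ), BetaLevel η f x₀ s hmax R Hs B j v z →
    30 ≤ v.im * stateKappa f j v → LightPairAt μ₀ f j v z →
      3 - C * (1 + μ₀) / (v.im * stateKappa f j v) ≤ ((v.im ^ 2 + z.im ^ 2) - childEnergy f j (pairUnion v z)) * stateKappa f j v ^ 2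

/-- §2 K-2′ implies K-2 (one binder fewer). -/
theorem perturbativeDropLightPairQ_of_noZ {C μ₀ : ℝ} (h : PerturbativeDropLightPairNoZQ C μ₀) : PerturbativeDropLightPairQ C μ₀ :=
  fun η f x₀ s hmax R Hs B hE j v z hβ hfl hL _ => h η f x₀ s hmax R Hs B hE j v z hβ hfl hL

/-- ★★ §2 **K-2′ FROM THE z-FLOOR-FREE BUDGET** (`μ₀ ≤ 1/2`): the compose `perturbativeDropLightPairQ_of_budget` replayed with ONE change — image E's door
smallness at `z`, `(9/2)(1+μ₀) ≤ (Im z·‖K_z‖)²/2`, is taken from the pair coherence (`explicit_coherence`: `Im v·‖K_z‖ ≥ Im v·κ_v − 13/2 ≥ 47/2`)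
instead of from a floor at `z`. -/
theorem perturbativeDropLightPairNoZQ_of_budgetNoZ {C μ₀ : ℝ} (hμ : μ₀ ≤ 1 / 2) (hGB : GeometricBudgetNoZ C μ₀) :
    PerturbativeDropLightPairNoZQ C μ₀ := by
  intro η f x₀ s hmax R Hs B hE j v z hβ hfl hL
  have hβ' := hβ
  obtain ⟨-, -, hlow, ht, hat⟩ := hβ'
  have hFv : iteratedDeriv j f v = 0 := hlow.1.2.1
  have hv : 0 < v.im := hlow.1.2.2.1
  obtain ⟨hFz, hab, htouch⟩ := ht
  have hz : 0 < z.im := hv.trans hab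
  have hvz : v ≠ z := fun e => by rw [e] at hab; exact lt_irrefl _ hab
  obtain ⟨M, hMμ, hWv, hWz, hsep, g, hg, hfac, hhull⟩ := hL
  have hM0 : 0 ≤ M := hWv.2.1
  have hLv : LightAt μ₀ f j v := ⟨M, hMμ, hWv⟩
  have hLz : LightAt μ₀ f j z := ⟨M, hMμ, hWz⟩
  -- the floor at `v` in both currencies, and E's door smallness at `v`
  have hfl' : 30 ≤ v.im * ‖newtonK f j v + I / (2 * (v.im : ℂ))‖ := hfl
  have hlamv : 59 / 2 ≤ v.im * ‖newtonK f j v‖ := by linarith [im_mul_norm_ge (K := newtonK f j v) hv]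
  have hdv : (9 / 2) * (1 + μ₀) ≤ (v.im * ‖newtonK f j v‖) ^ 2 / 2 := by nlinarith
  -- F: the pair form of the field at both points, `R_w = g′(w)/g(w)` (needs only the hull clause at the endpoints)
  have hgv : g v ≠ 0 := by simpa using (hhull 0 le_rfl zero_le_one).1
  have hgz : g z ≠ 0 := by simpa using (hhull 1 zero_le_one le_rfl).1
  have hFv' : ∀ u : ℂ, iteratedDeriv j f u = (u - v) * ((u - conj v) * ((u - z) * ((u - conj z) * g u))) := fun u => by
    rw [hfac u]; ring
  have hFz' : ∀ u : ℂ, iteratedDeriv j f u = (u - z) * ((u - conj z) * ((u - v) * ((u - conj v) * g u))) := fun u => by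
    rw [hfac u]; ring
  have hKv := RhW08.PairCoherence.newtonK_pair hv hz hvz hg.differentiableAt hgv hFv'
  have hKz := RhW08.PairCoherence.newtonK_pair hz hv hvz.symm hg.differentiableAt hgz hFz'
  -- F: the hull drift bound for `R = g′/g`
  set Rg : ℂ → ℂ := fun w => deriv g w / g w with hRgdef
  have hR : ∀ t : ℝ, 0 ≤ t → t ≤ 1 →
      DifferentiableAt ℂ Rg (v + (t : ℂ) * (z - v)) ∧ (v + (t : ℂ) * (z - v)).im ^ 2 * ‖deriv Rg (v + (t : ℂ) * (z - v))‖ ≤ M := by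
    intro t h0 h1
    obtain ⟨hne0, hbd⟩ := hhull t h0 h1
    exact ⟨((hg.analyticAt _).deriv.differentiableAt).div (hg _) hne0, hbd⟩
  have hdrift : ‖Rg z - Rg v‖ ≤ M * ‖z - v‖ / (v.im * z.im) := RhW08.PairCoherence.norm_sub_le_of_hull hv hab hR
  -- NEW (replaces the floor at `z`): coherence ⇒ `Im z·‖K_z‖ ≥ 47/2` ⇒ E's door smallness at `z`
  have hcoh : ‖newtonK f j z - newtonK f j v‖ ≤ 6 / v.im :=
    explicit_coherence hv hab htouch hsep (hMμ.trans hμ) hKv hKz hdrift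
  have hmz : v.im * ‖newtonK f j v + I / (2 * (v.im : ℂ))‖ - 13 / 2 ≤ v.im * ‖newtonK f j z‖ := by
    have h1 : ‖newtonK f j v‖ - ‖newtonK f j z‖ ≤ ‖newtonK f j v - newtonK f j z‖ := norm_sub_norm_le _ _
    rw [norm_sub_rev] at h1
    have h2 : v.im * (‖newtonK f j v‖ - ‖newtonK f j z‖) ≤ v.im * (6 / v.im) := mul_le_mul_of_nonneg_left (h1.trans hcoh) hv.le
    have h3 : v.im * (6 / v.im) = 6 := by field_simp
    nlinarith [im_mul_norm_ge (K := newtonK f j v) hv]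
  have hlamz : 47 / 2 ≤ z.im * ‖newtonK f j z‖ := by
    have h4 : v.im * ‖newtonK f j z‖ ≤ z.im * ‖newtonK f j z‖ := mul_le_mul_of_nonneg_right hab.le (norm_nonneg _)
    linarith
  have hdz : (9 / 2) * (1 + μ₀) ≤ (z.im * ‖newtonK f j z‖) ^ 2 / 2 := by
    have h47 : (47 / 2 : ℝ) ^ 2 ≤ (z.im * ‖newtonK f j z‖) ^ 2 := pow_le_pow_left₀ (by norm_num) hlamz 2
    linarith
  -- E: the two located children; C (34): they majorise the child energy of `Ū`
  obtain ⟨hsv, hsz, -, hlamz3, u₁, u₂, hne, ⟨hd1, hG1, hD1, hS1⟩, ⟨hd2, hG2, hD2, hS2⟩⟩ :=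
    RhW08.LocatedPair.located_pair_of_lightAt hE hFv hFz hv hz hvz hLv hLz hdv hdz
  have hCE : childEnergy f j (pairUnion v z) ≤ u₁.im ^ 2 + u₂.im ^ 2 :=
    RhW08.PairWindowCompose.childEnergyTwoLeQ_holds η f x₀ s hmax R Hs B hE j v z hβ hfl hlamz3 u₁ u₂ hne hd1 hG1 hd2 hG2 hD1 hD2
  -- D: the pair signs ⇒ `Im R_w ≤ 0`
  obtain ⟨hsgv, hsgz⟩ := RhW08.PairSign.im_newtonK_le_of_atomicPair hE hFv hFz hv hz hvz hsv hsz hat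
  have hRv : (deriv g v / g v).im ≤ 0 := by
    have e : (newtonK f j v).im = (-(1 / (2 * v.im)) + pairPull v z) + (deriv g v / g v).im := by
      rw [hKv, add_im, im_explicit]
    linarith
  have hRz : (deriv g z / g z).im ≤ 0 := by
    have e : (newtonK f j z).im = (-(1 / (2 * z.im)) + pairPull z v) + (deriv g z / g z).im := by
      rw [hKz, add_im, im_explicit]
    linarith
  -- the budget (no floor at `z` among its binders)
  have hB := hGB v z (Rg v) (Rg z) (newtonK f j v) (newtonK f j z) u₁ u₂ M hv hab htouch hsep hM0 hMμ hKv hKz hRv hRz hdrift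
    hfl' hS1 hS2
  have hκ : 0 ≤ ‖newtonK f j v + I / (2 * (v.im : ℂ))‖ ^ 2 := sq_nonneg _
  have hmono : ((v.im ^ 2 + z.im ^ 2) - (u₁.im ^ 2 + u₂.im ^ 2)) * ‖newtonK f j v + I / (2 * (v.im : ℂ))‖ ^ 2 ≤
      ((v.im ^ 2 + z.im ^ 2) - childEnergy f j (pairUnion v z)) * ‖newtonK f j v + I / (2 * (v.im : ℂ))‖ ^ 2 :=
    mul_le_mul_of_nonneg_right (by linarith) hκ
  exact hB.trans hmono

/-- ★★ §2 **K-2′ OF RECORD, HYPOTHESIS-FREE**: `PerturbativeDropLightPairNoZQ 10 (1/2)` — the light-pair drop at `(C, μ₀) = (10, 1/2)` WITHOUT any floor at `z`. -/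
theorem k2Z : PerturbativeDropLightPairNoZQ 10 (1 / 2) :=
  perturbativeDropLightPairNoZQ_of_budgetNoZ (by norm_num) geometricBudgetNoZ_ten_half

-- §2 sanity (an `example`, not a declaration: its statement is α-identical to the LANDED `RhW08.BudgetTable.k2`, #1224):
-- the tree's K-2 re-derived from K-2′.
example : PerturbativeDropLightPairQ 10 (1 / 2) := perturbativeDropLightPairQ_of_noZ k2Z

/-! ## §3 Glue: light pairs need no floor at `z`; the RUNG-P split without the z-floor; the fold of image P's regime 1 -/

/-- ★ §3 GLUE «LIGHT PAIRS ⇒ X ≥ 5/2, FLOOR AT `v` ONLY»: a β-level above the floor at `v` whose pair is light within `1/2` has `X ≥ 5/2`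
(`k2Z`: `X ≥ 3 − 15/λ_v ≥ 5/2`) — whatever `λ_z`. -/
theorem five_halves_of_lightPair (η : ℝ) (f : ℂ → ℂ) (x₀ s hmax R Hs : ℝ) (B : ℕ) (hE : RhIdea6.G17.W07C7.Rev6.EngineHyps5 2 η f x₀ s hmax R Hs B)
    (j : ℕ) (v z : ℂ) (hβ : BetaLevel η f x₀ s hmax R Hs B j v z) (hfl : 30 ≤ v.im * stateKappa f j v) (hL : LightPairAt (1 / 2) f j v z) :
    5 / 2 ≤ ((v.im ^ 2 + z.im ^ 2) - childEnergy f j (pairUnion v z)) * stateKappa f j v ^ 2 := by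
  have h := k2Z η f x₀ s hmax R Hs B hE j v z hβ hfl hL
  have hl : (0 : ℝ) < v.im * stateKappa f j v := by linarith
  have hq : 10 * (1 + 1 / 2) / (v.im * stateKappa f j v) ≤ 1 / 2 := by
    rw [div_le_iff₀ hl]; nlinarith
  linarith

/-- ★ §3 IMAGE P's REGIME 1 ON LIGHT PAIRS: `HeavySubfloorZQ` (β-level, `λ_v ≥ 30`, `λ_z < 30` ⇒ `X ≥ 5/2`) HOLDS on pairs light within `1/2` —
the subfloor binder is not even used. -/
theorem heavySubfloorZ_light (η : ℝ) (f : ℂ → ℂ) (x₀ s hmax R Hs : ℝ) (B : ℕ) (hE : RhIdea6.G17.W07C7.Rev6.EngineHyps5 2 η f x₀ s hmax R Hs B)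
    (j : ℕ) (v z : ℂ) (hβ : BetaLevel η f x₀ s hmax R Hs B j v z) (hfl : 30 ≤ v.im * stateKappa f j v)
    (_hsub : z.im * stateKappa f j z < 30) (hL : LightPairAt (1 / 2) f j v z) :
    5 / 2 ≤ ((v.im ^ 2 + z.im ^ 2) - childEnergy f j (pairUnion v z)) * stateKappa f j v ^ 2 :=
  five_halves_of_lightPair η f x₀ s hmax R Hs B hE j v z hβ hfl hL


/-- §3 ★ the HEAVY socket WITHOUT the floor at `z`: a β-level above the floor at `v` whose pair is NOT light within `μ₀` has `X ≥ 5/2`.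
(UNPROVED, substantive; it is IMPLIED BY the tree's `NearMassMonotonePairQ μ₀`, whose antecedent `¬(LightPairAt ∧ 30 ≤ λ_z)` is larger.) -/
def NearMassMonotonePairNoZQ (μ₀ : ℝ) : Prop :=
  ∀ (η : ℝ) (f : ℂ → ℂ) (x₀ s hmax R Hs : ℝ) (B : ℕ), RhIdea6.G17.W07C7.Rev6.EngineHyps5 2 η f x₀ s hmax R Hs B →
    ∀ (j : ℕ) (v z : ℂ), BetaLevel η f x₀ s hmax R Hs B j v z →
    30 ≤ v.im * stateKappa f j v → ¬ LightPairAt μ₀ f j v z →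
      5 / 2 ≤ ((v.im ^ 2 + z.im ^ 2) - childEnergy f j (pairUnion v z)) * stateKappa f j v ^ 2

/-- §3 the z-floor-free heavy socket is WEAKER than the tree's (#1190 `NearMassMonotonePairQ`). -/
theorem nearMassMonotonePairNoZQ_of_pair {μ₀ : ℝ} (h : NearMassMonotonePairQ μ₀) : NearMassMonotonePairNoZQ μ₀ :=
  fun η f x₀ s hmax R Hs B hE j v z hβ hfl hnl => h η f x₀ s hmax R Hs B hE j v z hβ hfl (fun hc => hnl hc.1)

/-- ★ §3 **RUNG-P FROM THE z-FLOOR-FREE SPLIT**: `C(1+μ₀) ≤ 15`, K-2′ and the z-floor-free heavy socket give RUNG-P (case on `LightPairAt μ₀` only). -/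
theorem rungP_of_noZ {C μ₀ : ℝ} (hCμ : C * (1 + μ₀) ≤ 15)
    (hL : PerturbativeDropLightPairNoZQ C μ₀) (hH : NearMassMonotonePairNoZQ μ₀) : RungP := by
  intro η f x₀ s hmax R Hs B hE j v z hch hA hlow ht ha hfl
  by_cases hlt : LightPairAt μ₀ f j v z
  · have h := hL η f x₀ s hmax R Hs B hE j v z ⟨hch, hA, hlow, ht, ha⟩ hfl hlt
    have hl : (0 : ℝ) < v.im * stateKappa f j v := by linarith
    have hq : C * (1 + μ₀) / (v.im * stateKappa f j v) ≤ 1 / 2 := by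
      rw [div_le_iff₀ hl]; nlinarith
    linarith
  · exact hH η f x₀ s hmax R Hs B hE j v z ⟨hch, hA, hlow, ht, ha⟩ hfl hlt

/-- ★ §3 the instance of record: with `k2Z` in hand, RUNG-P rests on `NearMassMonotonePairNoZQ (1/2)` ALONE. -/
theorem rungP_of_noZ_instance (hH : NearMassMonotonePairNoZQ (1 / 2)) : RungP := rungP_of_noZ (by norm_num) k2Z hH

/-- §3 regime 2′ (UNPROVED; `μ₀`-free; NO floor at `z`) NEAR-COINCIDENT pair: floor at `v`, `2‖v − z‖ < Im v` ⇒ `X ≥ 5/2`. -/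
def HeavyNearCoincidentNoZQ : Prop :=
  ∀ (η : ℝ) (f : ℂ → ℂ) (x₀ s hmax R Hs : ℝ) (B : ℕ), RhIdea6.G17.W07C7.Rev6.EngineHyps5 2 η f x₀ s hmax R Hs B →
    ∀ (j : ℕ) (v z : ℂ), BetaLevel η f x₀ s hmax R Hs B j v z →
    30 ≤ v.im * stateKappa f j v → 2 * ‖v - z‖ < v.im →
      5 / 2 ≤ ((v.im ^ 2 + z.im ^ 2) - childEnergy f j (pairUnion v z)) * stateKappa f j v ^ 2

/-- §3 regime 3′ (UNPROVED; NO floor at `z`) MASS: floor at `v`, separated (`Im v ≤ 2‖v − z‖`), NOT light within `μ₀` ⇒ `X ≥ 5/2`. -/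
def HeavyMassNoZQ (μ₀ : ℝ) : Prop :=
  ∀ (η : ℝ) (f : ℂ → ℂ) (x₀ s hmax R Hs : ℝ) (B : ℕ), RhIdea6.G17.W07C7.Rev6.EngineHyps5 2 η f x₀ s hmax R Hs B →
    ∀ (j : ℕ) (v z : ℂ), BetaLevel η f x₀ s hmax R Hs B j v z →
    30 ≤ v.im * stateKappa f j v → v.im ≤ 2 * ‖v - z‖ → ¬ LightPairAt μ₀ f j v z →
      5 / 2 ≤ ((v.im ^ 2 + z.im ^ 2) - childEnergy f j (pairUnion v z)) * stateKappa f j v ^ 2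

/-- ★ §3 the z-floor-free heavy socket SPLITS EXACTLY into regimes 2′ and 3′ (pure logic; tree `RhW08.HeavyPairSplit.sep_of_lightPairAt` by name;
P's regime 1 `HeavySubfloorZQ` has no counterpart). -/
theorem nearMassMonotonePairNoZQ_iff_split {μ₀ : ℝ} :
    NearMassMonotonePairNoZQ μ₀ ↔ HeavyNearCoincidentNoZQ ∧ HeavyMassNoZQ μ₀ := by
  constructor
  · intro h
    refine ⟨?_, ?_⟩
    · intro η f x₀ s hmax R Hs B hE j v z hβ hfl hnc
      exact h η f x₀ s hmax R Hs B hE j v z hβ hfl (fun hc => absurd (sep_of_lightPairAt hc) (not_le.mpr hnc))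
    · intro η f x₀ s hmax R Hs B hE j v z hβ hfl _ hnl
      exact h η f x₀ s hmax R Hs B hE j v z hβ hfl hnl
  · rintro ⟨h₂, h₃⟩ η f x₀ s hmax R Hs B hE j v z hβ hfl hnl
    by_cases hsep : v.im ≤ 2 * ‖v - z‖
    · exact h₃ η f x₀ s hmax R Hs B hE j v z hβ hfl hsep hnl
    · exact h₂ η f x₀ s hmax R Hs B hE j v z hβ hfl (lt_of_not_ge hsep)

/-- ★ §3 RUNG-P from the TWO z-floor-free regimes (light side = `k2Z`, in this file, hypothesis-free). -/
theorem rungP_of_two (h₂ : HeavyNearCoincidentNoZQ) (h₃ : HeavyMassNoZQ (1 / 2)) : RungP :=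
  rungP_of_noZ_instance (nearMassMonotonePairNoZQ_iff_split.mpr ⟨h₂, h₃⟩)

/-- §3 IMAGE P's regime 1, HEAVY REMAINDER (UNPROVED): β-level, floor at `v`, subfloor at `z` (`λ_z < 30`), NOT light within `μ₀` ⇒ `X ≥ 5/2`. -/
def HeavySubfloorHeavyQ (μ₀ : ℝ) : Prop :=
  ∀ (η : ℝ) (f : ℂ → ℂ) (x₀ s hmax R Hs : ℝ) (B : ℕ), RhIdea6.G17.W07C7.Rev6.EngineHyps5 2 η f x₀ s hmax R Hs B →
    ∀ (j : ℕ) (v z : ℂ), BetaLevel η f x₀ s hmax R Hs B j v z →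
    30 ≤ v.im * stateKappa f j v → z.im * stateKappa f j z < 30 → ¬ LightPairAt μ₀ f j v z →
      5 / 2 ≤ ((v.im ^ 2 + z.im ^ 2) - childEnergy f j (pairUnion v z)) * stateKappa f j v ^ 2

/-- ★ §3 THE FOLD OF REGIME 1: given `k2Z`, the tree's regime 1 `RhW08.HeavyPairSplit.HeavySubfloorZQ` (#1228) follows from its heavy remainder
at `μ₀ = 1/2` alone. -/
theorem heavySubfloorZ_of_remainder (h : HeavySubfloorHeavyQ (1 / 2)) : HeavySubfloorZQ := by
  intro η f x₀ s hmax R Hs B hE j v z hβ hfl hsub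
  by_cases hL : LightPairAt (1 / 2) f j v z
  · exact five_halves_of_lightPair η f x₀ s hmax R Hs B hE j v z hβ hfl hL
  · exact h η f x₀ s hmax R Hs B hE j v z hβ hfl hsub hL

/-- §3 … and the heavy remainder is a restriction of the z-floor-free heavy socket, hence of regimes 2′ ∧ 3′ (so regime 1 DISAPPEARS from the split). -/
theorem remainder_of_noZ {μ₀ : ℝ} (h : NearMassMonotonePairNoZQ μ₀) : HeavySubfloorHeavyQ μ₀ :=
  fun η f x₀ s hmax R Hs B hE j v z hβ hfl _ hnl => h η f x₀ s hmax R Hs B hE j v z hβ hfl hnl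

/-- §3 the heavy remainder of regime 1 from the two z-floor-free regimes 2′ ∧ 3′. -/
theorem remainder_of_two {μ₀ : ℝ} (h₂ : HeavyNearCoincidentNoZQ) (h₃ : HeavyMassNoZQ μ₀) : HeavySubfloorHeavyQ μ₀ :=
  remainder_of_noZ (nearMassMonotonePairNoZQ_iff_split.mpr ⟨h₂, h₃⟩)

/-- §3 the MASS socket without the floor at `z` gets weaker as `μ₀` grows. -/
theorem heavyMassNoZQ_mono {μ₀ μ₁ : ℝ} (hμ : μ₀ ≤ μ₁) (h : HeavyMassNoZQ μ₀) : HeavyMassNoZQ μ₁ :=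
  fun η f x₀ s hmax R Hs B hE j v z hβ hfl hsep hnl => h η f x₀ s hmax R Hs B hE j v z hβ hfl hsep (fun hL => hnl (lightPairAt_mono hμ hL))

/-! ## §4 By-name fold against the tree's three-regime split (`RhW08.HeavyPairSplit`, #1228) -/

/-- §4 regime 2′ (no floor at `z`) implies the tree's regime 2 `RhW08.HeavyPairSplit.HeavyNearCoincidentQ` (one binder more). -/
theorem heavyNearCoincidentQ_of_noZ (h : HeavyNearCoincidentNoZQ) : HeavyNearCoincidentQ :=
  fun η f x₀ s hmax R Hs B hE j v z hβ hfl _ hnc => h η f x₀ s hmax R Hs B hE j v z hβ hfl hnc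

/-- §4 regime 3′ (no floor at `z`) implies the tree's regime 3 `RhW08.HeavyPairSplit.HeavyMassQ μ₀` (one binder more). -/
theorem heavyMassQ_of_noZ {μ₀ : ℝ} (h : HeavyMassNoZQ μ₀) : HeavyMassQ μ₀ :=
  fun η f x₀ s hmax R Hs B hE j v z hβ hfl _ hsep hnl => h η f x₀ s hmax R Hs B hE j v z hβ hfl hsep hnl

/-- §4 the tree's three heavy sockets give the z-floor-free heavy socket (via `nearMassMonotonePairQ_of_split` and `nearMassMonotonePairNoZQ_of_pair`). -/
theorem noZ_of_split3 {μ₀ : ℝ} (h₁ : HeavySubfloorZQ) (h₂ : HeavyNearCoincidentQ) (h₃ : HeavyMassQ μ₀) : NearMassMonotonePairNoZQ μ₀ :=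
  nearMassMonotonePairNoZQ_of_pair (nearMassMonotonePairQ_of_split h₁ h₂ h₃)

/-- ★ §4 AT `μ₀ = 1/2` THE TWO SPLITS ARE EQUIVALENT (given `k2Z`): the tree's three heavy sockets ⟺ the two z-floor-free ones. -/
theorem split3_iff_two_half :
    (HeavySubfloorZQ ∧ HeavyNearCoincidentQ ∧ HeavyMassQ (1 / 2)) ↔ (HeavyNearCoincidentNoZQ ∧ HeavyMassNoZQ (1 / 2)) :=
  ⟨fun h => nearMassMonotonePairNoZQ_iff_split.mp (noZ_of_split3 h.1 h.2.1 h.2.2),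
   fun h => ⟨heavySubfloorZ_of_remainder (remainder_of_two h.1 h.2), heavyNearCoincidentQ_of_noZ h.1, heavyMassQ_of_noZ h.2⟩⟩

end RhW08.K2NoZFloor
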